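import Summits.HubbardSuperconductivity.HubbardSuperconductivity.Theorems.AnisotropyChordKnnTopSectors

/-!
# Route `AnisotropyChord` / H0 rotor rung, K_{n,n} sibling of XY-LM₀: the RATIO-MAJORANT bound for the drop of the
# Perron root between two Jacobi matrices (generic core of the Lean proof of the theory seat's LEMMA C / THEOREM Q⁺)
(prover seat `hubbard-h0-rotor-p1` g16; replaces the weighted-energy-estimate + Pólya-certificate reduction of theory seat
`hubbard-h0-rotor-theory-1`, memo ROTOR-THEORY-11 §167/§168, by a certificate-light variational/continued-fraction argument)

Setting (bottom-up levels, as in `…KnnBlock`): `P = jac m p c` (sector `M`, `m` levels, positive couplings) and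
`P' = jac m' p' c'` (sector `M+1`, `m = m' + s` levels, `s ∈ {0,1}`: for `s = 1` the bottom level of `P` is absent from
`P'`, level `k` of `P'` is level `k + s` of `P`).  Let `x` be a variational top vector of `P`, `λ = rayleigh P x ≥ p_{m−1}`.
* RATIOS (`ext0_le_ratio_mul`): if `T_k` satisfy `cU_k ≤ T_k · (p_{m−1} − p_k − cU_{k−1} T_{k−1})` with positive brackets
  (`c_k ≤ cU_k`), then `x_k ≤ T_k x_{k+1}` for every `k + 1 < m` (bottom-up continued-fraction majorant from the eigen-rows).
* DROP (`rayleigh_sub_le_horner`): with `d_k = p_{k+s} − p'_k ≥ 0` and `c_{k+s} − c'_k ≤ dcU_{k+s}` (`dcU ≥ 0`), testing `P'`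
  with the restriction of `x` gives `λ − λ' ≤ H_{m'−1}`, where the HORNER accumulator is
  `H_0 = d_0 + [s = 1] cU_0 T_0`, `H_{k+1} = d_{k+1} + 2 dcU_{k+s} T_{k+s} + T_{k+s}² H_k` (`horner`); the `[s = 1]` term is the
  exact contribution `c_0 x_0 x_1 = (λ − p_0) x_0²` of the vanished bottom level (bottom eigen-row).
No hypothesis is specific to `K_{n,n}`; the instantiation (AM–GM coupling bounds, the budget) is in `…KnnRatioBounds`.
-/

set_option linter.dupNamespace false
set_option autoImplicit false

noncomputable section

open Finset Matrix

namespace Summit.HubbardSuperconductivity.HubbardSuperconductivity.Theorems.AnisotropyChord.Knn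

/-! ## The Horner accumulator -/

/-- **Horner accumulator** of the ratio-majorant bound: `H_0 = d_0 + [s = 1] cU_0 T_0`,
`H_{k+1} = d_{k+1} + 2 dcU_{k+s} T_{k+s} + T_{k+s}² H_k`. [folklore] -/
def horner (d dcU cU T : ℕ → ℝ) (s : ℕ) : ℕ → ℝ
  | 0 => d 0 + (if s = 1 then cU 0 * T 0 else 0)
  | k + 1 => d (k + 1) + 2 * dcU (k + s) * T (k + s) + T (k + s) ^ 2 * horner d dcU cU T s k

/-- unfolding of `horner` at `0`. [folklore] -/
@[simp] theorem horner_zero (d dcU cU T : ℕ → ℝ) (s : ℕ) :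
    horner d dcU cU T s 0 = d 0 + (if s = 1 then cU 0 * T 0 else 0) := rfl

/-- unfolding of `horner` at a successor. [folklore] -/
@[simp] theorem horner_succ (d dcU cU T : ℕ → ℝ) (s k : ℕ) :
    horner d dcU cU T s (k + 1) = d (k + 1) + 2 * dcU (k + s) * T (k + s) + T (k + s) ^ 2 * horner d dcU cU T s k := rfl

/-- `H_k ≥ 0` when `d, dcU, T ≥ 0` on the relevant ranges and the base term is `≥ 0`. [folklore] -/
theorem horner_nonneg {d dcU cU T : ℕ → ℝ} {s m' : ℕ} (hd : ∀ k, k < m' → 0 ≤ d k) (hdcU : ∀ k, 0 ≤ dcU k)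
    (hT : ∀ k, k + 1 < m' + s → 0 ≤ T k) (hbase : 0 ≤ (if s = 1 then cU 0 * T 0 else 0)) :
    ∀ k, k < m' → 0 ≤ horner d dcU cU T s k := by
  intro k
  induction k with
  | zero => intro hk; rw [horner_zero]; exact add_nonneg (hd 0 hk) hbase
  | succ k ih =>
    intro hk
    rw [horner_succ]
    have h1 := hd (k + 1) hk
    have h2 : 0 ≤ 2 * dcU (k + s) * T (k + s) := mul_nonneg (mul_nonneg (by norm_num) (hdcU _)) (hT _ (by omega))
    have h3 : 0 ≤ T (k + s) ^ 2 * horner d dcU cU T s k := mul_nonneg (sq_nonneg _) (ih (by omega))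
    linarith

/-! ## Ratio bounds for the top vector -/

/-- the bracket `p_{m−1} − p_k − [k ≥ 1] cU_{k−1} T_{k−1}` of the continued-fraction majorant. [folklore] -/
def bracket (m : ℕ) (p cU T : ℕ → ℝ) (k : ℕ) : ℝ :=
  p (m - 1) - p k - (if k = 0 then 0 else cU (k - 1) * T (k - 1))

/-- the ratio bounds are positive: `0 < T_k` (`k + 1 < m`). [folklore] -/
theorem ratio_pos {m : ℕ} {p c cU T : ℕ → ℝ} (hc : ∀ k, k + 1 < m → 0 < c k) (hcU : ∀ k, k + 1 < m → c k ≤ cU k)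
    (hden : ∀ k, k + 1 < m → 0 < bracket m p cU T k) (hT : ∀ k, k + 1 < m → cU k ≤ T k * bracket m p cU T k)
    {k : ℕ} (hk : k + 1 < m) : 0 < T k := by
  have h1 : 0 < cU k := (hc k hk).trans_le (hcU k hk)
  have h2 := hden k hk
  have h3 := hT k hk
  by_contra h
  have h' : T k ≤ 0 := not_lt.mp h
  have : T k * bracket m p cU T k ≤ 0 := mul_nonpos_of_nonpos_of_nonneg h' h2.le
  linarith

/-- `λ ≥ p_{m−1}`: the Rayleigh quotient of a top vector dominates the top diagonal entry (top eigen-row). [folklore] -/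
theorem top_diag_le_rayleigh {m : ℕ} (hm : 0 < m) {p c : ℕ → ℝ} (hc : ∀ k, k + 1 < m → 0 < c k) {x : Fin m → ℝ}
    (hx : IsTopVector (jac m p c) x) : p (m - 1) ≤ rayleigh (jac m p c) x := by
  have hrow := eigen_row_of_isTopVector hx ⟨m - 1, by omega⟩
  simp only at hrow
  have hem : ext0 x (m - 1 + 1) = 0 := ext0_of_le x (k := m - 1 + 1) (by omega)
  rw [hem, mul_zero, add_zero] at hrow
  have hpos : 0 < ext0 x (m - 1) := by
    rw [ext0_of_lt x (by omega : m - 1 < m)]; exact isTopVector_pos hc hx ⟨m - 1, by omega⟩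
  have hlast : 0 ≤ (if m - 1 = 0 then (0 : ℝ) else c (m - 1 - 1) * ext0 x (m - 1 - 1)) := by
    split_ifs with h0
    · exact le_rfl
    · exact mul_nonneg (hc _ (by omega)).le (ext0_nonneg_of_isTopVector hx _)
  nlinarith

/-- **RATIO MAJORANT:** `x_k ≤ T_k · x_{k+1}` for every `k + 1 < m`, by induction up from the bottom eigen-row, using
`λ ≥ p_{m−1}`, `c ≤ cU` and `cU_k ≤ T_k (p_{m−1} − p_k − cU_{k−1} T_{k−1})`. [folklore] -/
theorem ext0_le_ratio_mul {m : ℕ} {p c cU T : ℕ → ℝ} (hc : ∀ k, k + 1 < m → 0 < c k)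
    (hcU : ∀ k, k + 1 < m → c k ≤ cU k) (hden : ∀ k, k + 1 < m → 0 < bracket m p cU T k)
    (hT : ∀ k, k + 1 < m → cU k ≤ T k * bracket m p cU T k) {x : Fin m → ℝ} (hx : IsTopVector (jac m p c) x) :
    ∀ k, k + 1 < m → ext0 x k ≤ T k * ext0 x (k + 1) := by
  set lam := rayleigh (jac m p c) x with hlam
  by_cases hm : 0 < m
  swap
  · intro k hk; omega
  have hlam0 : p (m - 1) ≤ lam := top_diag_le_rayleigh hm hc hx
  have hnn := ext0_nonneg_of_isTopVector hx
  intro k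
  induction k with
  | zero =>
    intro hk
    have hrow := eigen_row_of_isTopVector hx ⟨0, by omega⟩
    simp only [if_true, add_zero] at hrow
    have hb := hden 0 hk
    have ht := hT 0 hk
    simp only [bracket, if_true, sub_zero] at hb ht
    have hcu := hcU 0 hk
    have hc0 := hc 0 hk
    have he1 := hnn 1
    have he0 := hnn 0
    have hT0 : 0 < T 0 := ratio_pos hc hcU hden hT hk
    -- (lam − p 0) e0 = c0 e1 ≤ cU0 e1 ≤ T0 (p(m-1) − p0) e1 ≤ T0 (lam − p0) e1
    have h1 : (lam - p 0) * ext0 x 0 = c 0 * ext0 x 1 := by simp only [zero_add] at hrow; linarith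
    have h2 : (p (m - 1) - p 0) * ext0 x 0 ≤ (lam - p 0) * ext0 x 0 := mul_le_mul_of_nonneg_right (by linarith) he0
    have h3 : c 0 * ext0 x 1 ≤ T 0 * (p (m - 1) - p 0) * ext0 x 1 := by
      have := mul_le_mul_of_nonneg_right (hcu.trans ht) he1
      linarith
    have h4 : (p (m - 1) - p 0) * ext0 x 0 ≤ (p (m - 1) - p 0) * (T 0 * ext0 x 1) := by nlinarith
    exact le_of_mul_le_mul_left h4 hb
  | succ k ih =>
    intro hk
    have ih' := ih (by omega)
    have hrow := eigen_row_of_isTopVector hx ⟨k + 1, by omega⟩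
    simp only [Nat.succ_ne_zero, if_false, Nat.add_sub_cancel] at hrow
    have hb := hden (k + 1) hk
    have ht := hT (k + 1) hk
    simp only [bracket, Nat.succ_ne_zero, if_false, Nat.add_sub_cancel] at hb ht
    have hcu := hcU (k + 1) hk
    have hcu' := hcU k (by omega)
    have hck := hc k (by omega)
    have hck1 := hc (k + 1) hk
    have he0 := hnn k
    have he1 := hnn (k + 1)
    have he2 := hnn (k + 1 + 1)
    have hTk : 0 < T k := ratio_pos hc hcU hden hT (by omega)
    have hTk1 : 0 < T (k + 1) := ratio_pos hc hcU hden hT hk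
    -- the back-coupling term: c_k e_k ≤ cU_k T_k e_{k+1}
    have hbk : c k * ext0 x k ≤ cU k * T k * ext0 x (k + 1) := by
      calc c k * ext0 x k ≤ c k * (T k * ext0 x (k + 1)) := mul_le_mul_of_nonneg_left ih' hck.le
        _ ≤ cU k * (T k * ext0 x (k + 1)) := mul_le_mul_of_nonneg_right hcu' (mul_nonneg hTk.le he1)
        _ = cU k * T k * ext0 x (k + 1) := by ring
    -- (lam − p_{k+1} − cU_k T_k) e_{k+1} ≤ c_{k+1} e_{k+2} ≤ cU_{k+1} e_{k+2}
    have h1 : (lam - p (k + 1) - cU k * T k) * ext0 x (k + 1) ≤ cU (k + 1) * ext0 x (k + 1 + 1) := by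
      have := mul_le_mul_of_nonneg_right hcu he2
      nlinarith
    have h2 : (p (m - 1) - p (k + 1) - cU k * T k) * ext0 x (k + 1)
        ≤ (lam - p (k + 1) - cU k * T k) * ext0 x (k + 1) := mul_le_mul_of_nonneg_right (by linarith) he1
    have h3 : cU (k + 1) * ext0 x (k + 1 + 1)
        ≤ T (k + 1) * (p (m - 1) - p (k + 1) - cU k * T k) * ext0 x (k + 1 + 1) :=
      mul_le_mul_of_nonneg_right ht he2
    have h4 : (p (m - 1) - p (k + 1) - cU k * T k) * ext0 x (k + 1)
        ≤ (p (m - 1) - p (k + 1) - cU k * T k) * (T (k + 1) * ext0 x (k + 1 + 1)) := by nlinarith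
    exact le_of_mul_le_mul_left h4 hb

/-! ## The drop bound -/

/-- splitting off the bottom term of a range sum shifted by `s ∈ {0,1}`. [folklore] -/
theorem sum_range_shift (g : ℕ → ℝ) (m' s : ℕ) (hs : s ≤ 1) :
    ∑ j ∈ range (m' + s), g j = (if s = 1 then g 0 else 0) + ∑ k ∈ range m', g (k + s) := by
  rcases Nat.le_one_iff_eq_zero_or_eq_one.mp hs with rfl | rfl
  · simp
  · rw [Finset.sum_range_succ', if_pos rfl, add_comm]

/-- Horner accumulation: the partial `E`-sums are bounded by `H_k x_{k+s}²`. [folklore] -/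
theorem esum_le_horner {m m' s : ℕ} (hms : m = m' + s) {d dcU cU T : ℕ → ℝ} {e : ℕ → ℝ}
    (hnn : ∀ k, 0 ≤ e k) (hratio : ∀ k, k + 1 < m → e k ≤ T k * e (k + 1))
    (hd : ∀ k, k < m' → 0 ≤ d k) (hdcU : ∀ k, 0 ≤ dcU k) (hT : ∀ k, k + 1 < m → 0 ≤ T k)
    (hbase : 0 ≤ (if s = 1 then cU 0 * T 0 else 0)) :
    ∀ k, k < m' →
      (∑ i ∈ range (k + 1), d i * e (i + s) ^ 2) + (∑ i ∈ range k, 2 * dcU (i + s) * e (i + s) * e (i + s + 1))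
        + (if s = 1 then cU 0 * T 0 else 0) * e s ^ 2
      ≤ horner d dcU cU T s k * e (k + s) ^ 2 := by
  have hT' : ∀ k, k + 1 < m' + s → 0 ≤ T k := by rw [← hms]; exact hT
  intro k
  induction k with
  | zero =>
    intro _
    simp only [zero_add, Finset.sum_range_one, Finset.sum_range_zero, add_zero, horner_zero]
    ring_nf; exact le_rfl
  | succ k ih =>
    intro hk
    have ih' := ih (by omega)
    rw [Finset.sum_range_succ (fun i => d i * e (i + s) ^ 2) (k + 1),
      Finset.sum_range_succ (fun i => 2 * dcU (i + s) * e (i + s) * e (i + s + 1)) k, horner_succ]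
    have hr : e (k + s) ≤ T (k + s) * e (k + s + 1) := hratio (k + s) (by omega)
    have hH := horner_nonneg hd hdcU hT' hbase k (by omega)
    have hTk := hT (k + s) (by omega)
    have he1 := hnn (k + s + 1)
    have he0 := hnn (k + s)
    have hdc := hdcU (k + s)
    -- cross term
    have h1 : 2 * dcU (k + s) * e (k + s) * e (k + s + 1) ≤ 2 * dcU (k + s) * T (k + s) * e (k + s + 1) ^ 2 := by
      have := mul_le_mul_of_nonneg_right hr he1
      have h2dc : 0 ≤ 2 * dcU (k + s) := by linarith
      nlinarith
    -- Horner term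
    have h2 : horner d dcU cU T s k * e (k + s) ^ 2 ≤ horner d dcU cU T s k * (T (k + s) ^ 2 * e (k + s + 1) ^ 2) := by
      apply mul_le_mul_of_nonneg_left _ hH
      have : e (k + s) ^ 2 ≤ (T (k + s) * e (k + s + 1)) ^ 2 := pow_le_pow_left₀ he0 hr 2
      rw [mul_pow] at this; exact this
    have e1 : (k + 1 + s) = (k + s + 1) := by ring
    rw [e1]
    nlinarith

/-- **THE RATIO-MAJORANT DROP BOUND.**  For Jacobi matrices `P = jac m p c` (positive couplings `c ≤ cU`) and
`P' = jac m' p' c'` with `m = m' + s`, `s ∈ {0,1}`, diagonal drops `d_k = p_{k+s} − p'_k ≥ 0`, coupling drops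
`c_{k+s} − c'_k ≤ dcU_{k+s}` (`dcU ≥ 0`) and ratio bounds `T` as in `ext0_le_ratio_mul`:
`rayleigh P x − rayleigh P' x' ≤ H_{m'−1}` for all top vectors `x, x'` (`horner`).  Proof: test `P'` with the restriction
`y_k = x_{k+s}`; `⟨y,P'y⟩ ≥ λ‖y‖² + [s=1](λ x_0² − p_0 x_0² − 2c_0x_0x_1) − E` with `E = Σ d x² + 2Σ dcU x x`, the bottom
eigen-row turns the bracket into `−c_0 x_0 x_1 ≥ −cU_0 T_0 x_1²`, Horner accumulation gives `≤ H_{m'−1} x_{m−1}²`, and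
`‖y‖² ≥ x_{m−1}²`. [folklore] -/
theorem rayleigh_sub_le_horner {m m' s : ℕ} (hms : m = m' + s) (hs : s ≤ 1) (hm' : 0 < m')
    {p c p' c' cU dcU T : ℕ → ℝ}
    (hc : ∀ k, k + 1 < m → 0 < c k) (hcU : ∀ k, k + 1 < m → c k ≤ cU k)
    (hdc : ∀ k, k + 1 < m' → c (k + s) - c' k ≤ dcU (k + s)) (hdcU : ∀ k, 0 ≤ dcU k)
    (hd : ∀ k, k < m' → 0 ≤ p (k + s) - p' k)
    (hden : ∀ k, k + 1 < m → 0 < bracket m p cU T k) (hT : ∀ k, k + 1 < m → cU k ≤ T k * bracket m p cU T k)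
    {x : Fin m → ℝ} {x' : Fin m' → ℝ} (hx : IsTopVector (jac m p c) x) (hx' : IsTopVector (jac m' p' c') x') :
    rayleigh (jac m p c) x - rayleigh (jac m' p' c') x'
      ≤ horner (fun k => p (k + s) - p' k) dcU cU T s (m' - 1) := by
  set lam := rayleigh (jac m p c) x with hlam
  set lam' := rayleigh (jac m' p' c') x' with hlam'
  set d : ℕ → ℝ := fun k => p (k + s) - p' k with hdd
  set e := ext0 x with he
  have hm : 0 < m := by omega
  have hnn : ∀ k, 0 ≤ e k := ext0_nonneg_of_isTopVector hx
  have hTnn : ∀ k, k + 1 < m → 0 ≤ T k := fun k hk => (ratio_pos hc hcU hden hT hk).le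
  have hratio : ∀ k, k + 1 < m → e k ≤ T k * e (k + 1) := ext0_le_ratio_mul hc hcU hden hT hx
  have hbase : 0 ≤ (if s = 1 then cU 0 * T 0 else 0) := by
    split_ifs with h1
    · have h2 : 0 + 1 < m := by omega
      exact mul_nonneg ((hc 0 h2).le.trans (hcU 0 h2)) (hTnn 0 h2)
    · exact le_rfl
  -- the restricted test vector
  set y : Fin m' → ℝ := fun i => x ⟨i.val + s, by omega⟩ with hy
  have hey : ∀ k, ext0 y k = e (k + s) := by
    intro k
    by_cases hk : k < m'
    · rw [ext0_of_lt y hk, he, ext0_of_lt x (by omega : k + s < m)]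
    · rw [ext0_of_le y (not_lt.mp hk), he, ext0_of_le x (by omega)]
  -- quadratic forms
  have hyy : y ⬝ᵥ y = ∑ k ∈ range m', e (k + s) ^ 2 := by
    rw [← sum_range_ext0_sq]; exact Finset.sum_congr rfl fun k _ => by rw [hey]
  have hrange : range m = range (m' + s) := by rw [hms]
  have hxx : x ⬝ᵥ x = (if s = 1 then e 0 ^ 2 else 0) + ∑ k ∈ range m', e (k + s) ^ 2 := by
    rw [← sum_range_ext0_sq, hrange, sum_range_shift (fun j => ext0 x j ^ 2) m' s hs]
  have hyPy : y ⬝ᵥ (jac m' p' c' *ᵥ y) = ∑ k ∈ range m', (p' k * e (k + s) ^ 2 + 2 * c' k * e (k + s) * e (k + s + 1)) := by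
    rw [jac_quadForm]; exact Finset.sum_congr rfl fun k _ => by rw [hey, hey, Nat.add_right_comm]
  have hxPx : x ⬝ᵥ (jac m p c *ᵥ x) = (if s = 1 then p 0 * e 0 ^ 2 + 2 * c 0 * e 0 * e (0 + 1) else 0)
      + ∑ k ∈ range m', (p (k + s) * e (k + s) ^ 2 + 2 * c (k + s) * e (k + s) * e (k + s + 1)) := by
    rw [jac_quadForm, hrange,
      sum_range_shift (fun j => p j * ext0 x j ^ 2 + 2 * c j * ext0 x j * ext0 x (j + 1)) m' s hs]
  have hxne := hx.1
  have hxx_pos := dotProduct_self_pos_of_ne_zero hxne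
  have hxPx' : x ⬝ᵥ (jac m p c *ᵥ x) = lam * (x ⬝ᵥ x) := quadForm_eq_rayleigh_mul _ hxne
  -- maximality of x'
  have hmax : y ⬝ᵥ (jac m' p' c' *ᵥ y) ≤ lam' * (y ⬝ᵥ y) := quadForm_le_rayleigh_mul hx' y
  -- termwise lower bound for ⟨y, P' y⟩
  have hterm : ∀ k ∈ range m', (p (k + s) * e (k + s) ^ 2 + 2 * c (k + s) * e (k + s) * e (k + s + 1))
      - (d k * e (k + s) ^ 2 + 2 * dcU (k + s) * e (k + s) * e (k + s + 1))
      ≤ p' k * e (k + s) ^ 2 + 2 * c' k * e (k + s) * e (k + s + 1) := by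
    intro k hk
    rw [mem_range] at hk
    have hdk : p' k = p (k + s) - d k := by rw [hdd]; ring
    rw [hdk]
    by_cases hk1 : k + 1 < m'
    · have h1 := hdc k hk1
      have h2 : 0 ≤ e (k + s) * e (k + s + 1) := mul_nonneg (hnn _) (hnn _)
      nlinarith
    · have hz : e (k + s + 1) = 0 := by rw [he, ext0_of_le x (by omega)]
      rw [hz]; ring_nf; exact le_rfl
  have hlow : (∑ k ∈ range m', (p (k + s) * e (k + s) ^ 2 + 2 * c (k + s) * e (k + s) * e (k + s + 1)))
      - (∑ k ∈ range m', (d k * e (k + s) ^ 2 + 2 * dcU (k + s) * e (k + s) * e (k + s + 1)))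
      ≤ y ⬝ᵥ (jac m' p' c' *ᵥ y) := by
    rw [hyPy, ← Finset.sum_sub_distrib]; exact Finset.sum_le_sum hterm
  -- the E-sum, with its last (vanishing) cross term removed, in Horner form
  obtain ⟨k0, hk0⟩ : ∃ k0, m' = k0 + 1 := ⟨m' - 1, by omega⟩
  have hElast : ∑ k ∈ range m', (d k * e (k + s) ^ 2 + 2 * dcU (k + s) * e (k + s) * e (k + s + 1))
      = (∑ i ∈ range (k0 + 1), d i * e (i + s) ^ 2) + ∑ i ∈ range k0, 2 * dcU (i + s) * e (i + s) * e (i + s + 1) := by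
    rw [hk0, Finset.sum_add_distrib, Finset.sum_range_succ (fun i => 2 * dcU (i + s) * e (i + s) * e (i + s + 1))]
    have hz : e (k0 + s + 1) = 0 := by rw [he, ext0_of_le x (by omega)]
    rw [hz]; ring
  have hH := esum_le_horner hms hnn hratio hd hdcU hTnn hbase k0 (by omega)
  have hHnn : 0 ≤ horner d dcU cU T s k0 :=
    horner_nonneg hd hdcU (by rw [← hms]; exact hTnn) hbase k0 (by omega)
  -- the vanished-level term via the bottom eigen-row: s·(p0 e0² + 2 c0 e0 e1 − lam e0²) = s·c0 e0 e1 ≤ s·cU0 T0 e_s²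
  have hvan : (if s = 1 then p 0 * e 0 ^ 2 + 2 * c 0 * e 0 * e (0 + 1) else 0) - lam * (if s = 1 then e 0 ^ 2 else 0)
      ≤ (if s = 1 then cU 0 * T 0 else 0) * e s ^ 2 := by
    split_ifs with h1
    · subst h1
      have h2 : 0 + 1 < m := by omega
      have hrow := eigen_row_of_isTopVector hx ⟨0, hm⟩
      simp only [if_true, add_zero] at hrow
      have hr0 := hratio 0 h2
      have hc0 := hc 0 h2
      have hcu0 := hcU 0 h2
      have hT0 := hTnn 0 h2
      have he1 := hnn 1
      have he0 := hnn 0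
      simp only [zero_add] at hrow hr0 ⊢
      -- lam e0 = p0 e0 + c0 e1
      have hkey : p 0 * e 0 ^ 2 + 2 * c 0 * e 0 * e 1 - lam * e 0 ^ 2 = c 0 * e 0 * e 1 := by
        have : lam * e 0 * e 0 = (p 0 * e 0 + c 0 * e 1) * e 0 := by rw [← hrow]
        nlinarith
      rw [hkey]
      calc c 0 * e 0 * e 1 ≤ c 0 * (T 0 * e 1) * e 1 := by
            apply mul_le_mul_of_nonneg_right _ he1; exact mul_le_mul_of_nonneg_left hr0 hc0.le
        _ ≤ cU 0 * (T 0 * e 1) * e 1 := by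
            apply mul_le_mul_of_nonneg_right _ he1; exact mul_le_mul_of_nonneg_right hcu0 (mul_nonneg hT0 he1)
        _ = cU 0 * T 0 * e 1 ^ 2 := by ring
    · simp
  -- ‖y‖² ≥ e_{m−1}²
  have hW : e (k0 + s) ^ 2 ≤ ∑ k ∈ range m', e (k + s) ^ 2 := by
    rw [hk0]
    exact Finset.single_le_sum (f := fun k => e (k + s) ^ 2) (fun k _ => sq_nonneg _) (mem_range.mpr (by omega))
  have hWpos : 0 < ∑ k ∈ range m', e (k + s) ^ 2 := by
    have : 0 < e (k0 + s) := by
      rw [he, ext0_of_lt x (by omega : k0 + s < m)]; exact isTopVector_pos hc hx ⟨k0 + s, by omega⟩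
    have : 0 < e (k0 + s) ^ 2 := by positivity
    linarith
  -- assemble: (lam − lam') W ≤ H e² ≤ H W
  have hmain : (lam - lam') * (∑ k ∈ range m', e (k + s) ^ 2)
      ≤ horner d dcU cU T s k0 * (∑ k ∈ range m', e (k + s) ^ 2) := by
    have step1 : (lam - lam') * (∑ k ∈ range m', e (k + s) ^ 2)
        ≤ (∑ k ∈ range m', (d k * e (k + s) ^ 2 + 2 * dcU (k + s) * e (k + s) * e (k + s + 1)))
          + ((if s = 1 then p 0 * e 0 ^ 2 + 2 * c 0 * e 0 * e (0 + 1) else 0) - lam * (if s = 1 then e 0 ^ 2 else 0)) := by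
      rw [hyy] at hmax
      have hq : lam * ((if s = 1 then e 0 ^ 2 else 0) + ∑ k ∈ range m', e (k + s) ^ 2)
          = (if s = 1 then p 0 * e 0 ^ 2 + 2 * c 0 * e 0 * e (0 + 1) else 0)
            + ∑ k ∈ range m', (p (k + s) * e (k + s) ^ 2 + 2 * c (k + s) * e (k + s) * e (k + s + 1)) := by
        rw [← hxx, ← hxPx', hxPx]
      nlinarith
    have step2 : (∑ k ∈ range m', (d k * e (k + s) ^ 2 + 2 * dcU (k + s) * e (k + s) * e (k + s + 1)))
          + ((if s = 1 then p 0 * e 0 ^ 2 + 2 * c 0 * e 0 * e (0 + 1) else 0) - lam * (if s = 1 then e 0 ^ 2 else 0))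
        ≤ horner d dcU cU T s k0 * e (k0 + s) ^ 2 := by
      rw [hElast]; linarith
    have step3 : horner d dcU cU T s k0 * e (k0 + s) ^ 2 ≤ horner d dcU cU T s k0 * (∑ k ∈ range m', e (k + s) ^ 2) :=
      mul_le_mul_of_nonneg_left hW hHnn
    linarith
  have hfin : lam - lam' ≤ horner d dcU cU T s k0 := le_of_mul_le_mul_right hmain hWpos
  have hk0' : m' - 1 = k0 := by omega
  rw [hk0']
  exact hfin

end Summit.HubbardSuperconductivity.HubbardSuperconductivity.Theorems.AnisotropyChord.Knn
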